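import Mathlib
import Summits.KontsevichZagierPeriods.Zeta5Search.SecondOrderTypes
import HarnessLib

/-!
# ζ(5) search — gen-2 g10's RAISE LEMMA at the level of exponent types (tools for THEOREM A‴ / `LawA3`)

Cell `pub-zeta5` (HONEST FRAMING: systematic search; no irrationality claim unless certified), typer seat generation 11.
REPORT-gen2-g10 §2.2: for a type `T = (L, e)` the first-digit functionals `σ = (ŵ, v̂)` of its SINGLE RAISES are functionals of
`(η − c)Φ_T`:
* `typeW_raiseAt` / `typeV_raiseAt` — raise at an existing level `k ≤ L` (`Φ_{T+δ_k} = (η − k)Φ_T`): `σ(T+δ_k) = σ₂(T) − k σ(T)`;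
* `typeW_snocOne` / `typeV_snocOne` — a new end point `T ++ [1]`: `σ = σ₂(T) − (L+1) σ(T)`;
* `typeW_consOne` / `typeV_consOne` — a new first point `1 :: T` (levels shifted by one): `ŵ = ŵ₂(T) + ŵ(T)` and
  `v̂ = v̂₂(T) + v̂(T) + corr(T)` with the translation term `corr(T) = Σ_{i,σ} (−1)^σ ρ[(η+1)Φ_T]_{i,σ} (i+1)^{−σ}`
  (the principal parts of `(η+1)Φ_T` evaluated at `η = −1`; it VANISHES for a realised type of negative degree — proved in the
  pair/assembly files from the partial-fraction identity `classPF`).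
(The pair form `σ(S) + σ(S^rev) = τ(T)` is assembled in `SecondOrderRaisePair.lean`.)  All four rest on ONE coefficient identity, `[ε^m](G·(ε + δ)) = δ[ε^m]G + [ε^{m−1}]G` (`coeff_mul_X_add_C'`), applied to the type
products `G_i = ∏_{j ≠ i}(i − j + ε)^{e_j}`.  Pure power-series algebra over `ℚ`; nothing here bears on irrationality.
-/

noncomputable section

open Finset PowerSeries

namespace Summit.KontsevichZagierPeriods.Zeta5Search.SecondOrder

open Summit.KontsevichZagierPeriods.Zeta5Search.ClusterValuation
open Summit.KontsevichZagierPeriods.Zeta5Search.LevelClass (typeRho typeW typeV typeExp)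
open Summit.KontsevichZagierPeriods.Zeta5Search.CellA (harm_succ)
open Literature.NumberTheory.Transcendental.BallRivoal (harm)

/-! ## §1 The coefficient identity and the type products -/

/-- `[X^m](G·(X + δ)) = δ·[X^m]G + [X^{m−1}]G` (the second term absent for `m = 0`). -/
theorem coeff_mul_X_add_C' (G : PowerSeries ℚ) (δ : ℚ) (m : ℕ) :
    coeff m (G * (X + C δ)) = δ * coeff m G + (if m = 0 then 0 else coeff (m - 1) G) := by
  rw [mul_add, mul_comm G X, map_add, coeff_mul_C]
  rcases Nat.eq_zero_or_pos m with rfl | hm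
  · rw [coeff_zero_X_mul, if_pos rfl]; ring
  · obtain ⟨i, rfl⟩ : ∃ i, m = i + 1 := ⟨m - 1, by omega⟩
    rw [coeff_succ_X_mul, if_neg (by omega), Nat.add_sub_cancel]; ring

/-- The type product at the point `i`: `G_i(ε) = ∏_{j ≤ L, j ≠ i} (i − j + ε)^{e_j}`. -/
def typeProd (L : ℕ) (e : ℕ → ℤ) (i : ℕ) : PowerSeries ℚ :=
  ∏ j ∈ (range (L + 1)).erase i, binomSeries ((i : ℚ) - j) (e j)

/-- `ρ^T_{i,σ} = [ε^{n_i − σ}] G_i`. -/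
theorem typeRho_eq (L : ℕ) (e : ℕ → ℤ) (i σ : ℕ) : typeRho L e i σ = coeff ((-e i).toNat - σ) (typeProd L e i) := rfl

/-- `typeProd` only sees `e` off `i`. -/
theorem typeProd_congr_off {L : ℕ} {e e' : ℕ → ℤ} {i : ℕ} (h : ∀ j ≤ L, j ≠ i → e j = e' j) :
    typeProd L e i = typeProd L e' i :=
  prod_congr rfl fun j hj => by
    obtain ⟨hji, hjr⟩ := mem_erase.1 hj
    rw [h j (by have := mem_range.1 hjr; omega) hji]

/-- **Raising the exponent at `k ≠ i` multiplies `G_i` by `(i − k) + ε`.** -/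
theorem typeProd_raiseAt {L : ℕ} (e : ℕ → ℤ) {i k : ℕ} (hk : k ≤ L) (hik : i ≠ k) :
    typeProd L (raiseAt e k) i = typeProd L e i * (X + C ((i : ℚ) - k)) := by
  have hkmem : k ∈ (range (L + 1)).erase i := mem_erase.2 ⟨fun h => hik h.symm, mem_range.2 (by omega)⟩
  have hδ : ((i : ℚ) - k) ≠ 0 := sub_ne_zero.2 (by exact_mod_cast hik)
  unfold typeProd
  rw [← mul_prod_erase _ _ hkmem, ← mul_prod_erase ((range (L + 1)).erase i) _ hkmem]
  have hrest : ∏ j ∈ ((range (L + 1)).erase i).erase k, binomSeries ((i : ℚ) - j) (raiseAt e k j) =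
      ∏ j ∈ ((range (L + 1)).erase i).erase k, binomSeries ((i : ℚ) - j) (e j) :=
    prod_congr rfl fun j hj => by rw [raiseAt, if_neg (mem_erase.1 hj).1]
  rw [hrest, raiseAt, if_pos rfl, ← linS_mul_binomSeries hδ (e k)]
  ring

/-- At the raised point itself the product is unchanged. -/
theorem typeProd_raiseAt_self {L : ℕ} (e : ℕ → ℤ) (k : ℕ) : typeProd L (raiseAt e k) k = typeProd L e k :=
  typeProd_congr_off fun j _ hj => by rw [raiseAt, if_neg hj]

/-- **`ρ` of a raised type at `i ≠ k`**: `ρ^{T+δ_k}_{i,σ} = (i − k)ρ_{i,σ} + ρ_{i,σ+1}[σ+1 ≤ n_i]` (`σ ≤ n_i`). -/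
theorem typeRho_raiseAt {L : ℕ} (e : ℕ → ℤ) {i k : ℕ} (hk : k ≤ L) (hik : i ≠ k) {σ : ℕ} (hσ : (σ : ℤ) ≤ -e i) :
    typeRho L (raiseAt e k) i σ =
      ((i : ℚ) - k) * typeRho L e i σ + (if (σ : ℤ) + 1 ≤ -e i then typeRho L e i (σ + 1) else 0) := by
  have hei : raiseAt e k i = e i := by rw [raiseAt, if_neg hik]
  rw [typeRho_eq, typeRho_eq, typeRho_eq, hei, typeProd_raiseAt e hk hik, coeff_mul_X_add_C']
  congr 1
  by_cases h1 : (σ : ℤ) + 1 ≤ -e i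
  · rw [if_pos h1, if_neg (by omega), show (-e i).toNat - σ - 1 = (-e i).toNat - (σ + 1) by omega]
  · rw [if_neg h1, if_pos (by omega)]

/-- **`ρ` of a raised type at the raised pole**: `ρ^{T+δ_k}_{k,σ} = ρ_{k,σ+1}`. -/
theorem typeRho_raiseAt_self {L : ℕ} (e : ℕ → ℤ) (k σ : ℕ) :
    typeRho L (raiseAt e k) k σ = typeRho L e k (σ + 1) := by
  rw [typeRho_eq, typeRho_eq, typeProd_raiseAt_self, raiseAt, if_pos rfl,
    show (-(e k + 1)).toNat - σ = (-e k).toNat - (σ + 1) by omega]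

/-! ## §2 Raise at an existing level: `σ(T + δ_k) = σ₂(T) − k σ(T)` -/

/-- **`ŵ(T+δ_k) = ŵ₂(T) − k ŵ(T)`** for `k ≤ L`. -/
theorem typeW_raiseAt {L : ℕ} (e : ℕ → ℤ) {k : ℕ} (hk : k ≤ L) :
    typeW L (raiseAt e k) = typeW2 L e - (k : ℚ) * typeW L e := by
  unfold typeW typeW2
  rw [sum_filter, sum_filter, sum_filter, mul_sum, ← sum_sub_distrib]
  refine sum_congr rfl fun i hi => ?_
  have hiL : i ≤ L := by have := mem_range.1 hi; omega
  by_cases hik : i = k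
  · subst hik
    have hr : raiseAt e i i = e i + 1 := by rw [raiseAt, if_pos rfl]
    rw [hr]
    by_cases h4 : e i ≤ -4
    · rw [if_pos (by omega), if_pos (by omega), typeRho_raiseAt_self]
      simp only [show e i < 0 by omega, show e i ≤ -3 by omega, h4, if_true]
      ring
    · have hl : (if e i + 1 < 0 then (if e i + 1 ≤ -3 then typeRho L (raiseAt e i) i 3 else 0) else (0 : ℚ)) = 0 := by
        split_ifs <;> first | rfl | omega
      rw [hl, if_neg h4]
      split_ifs <;> ring
  · have hr : raiseAt e k i = e i := by rw [raiseAt, if_neg hik]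
    rw [hr]
    by_cases h0 : e i < 0
    · rw [if_pos h0, if_pos h0, if_pos h0]
      by_cases h3 : e i ≤ -3
      · rw [if_pos h3, if_pos h3, if_pos h3, typeRho_raiseAt e hk hik (by push_cast; omega)]
        by_cases h4 : e i ≤ -4
        · rw [if_pos (by push_cast; omega), if_pos h4]; ring
        · rw [if_neg (by push_cast; omega), if_neg h4]; ring
      · rw [if_neg h3, if_neg h3, if_neg h3, if_neg (by omega)]; ring
    · rw [if_neg h0, if_neg h0, if_neg h0]; ring

/-- **`v̂(T+δ_k) = v̂₂(T) − k v̂(T)`** for `k ≤ L`. -/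
theorem typeV_raiseAt {L : ℕ} (e : ℕ → ℤ) {k : ℕ} (hk : k ≤ L) :
    typeV L (raiseAt e k) = typeV2 L e - (k : ℚ) * typeV L e := by
  unfold typeV typeV2
  rw [sum_filter, sum_filter, sum_filter, mul_sum, ← sum_sub_distrib]
  refine sum_congr rfl fun i hi => ?_
  have hiL : i ≤ L := by have := mem_range.1 hi; omega
  by_cases hik : i = k
  · subst hik
    have hr : raiseAt e i i = e i + 1 := by rw [raiseAt, if_pos rfl]
    rw [hr]
    by_cases h2 : e i ≤ -2
    · -- the pole survives with order `n − 1`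
      rw [if_pos (by omega), if_pos (by omega), if_pos (by omega), mul_sum, ← sum_sub_distrib]
      obtain ⟨n, hn⟩ : ∃ n : ℕ, (-e i).toNat = n + 1 := ⟨(-e i).toNat - 1, by omega⟩
      rw [show (-(e i + 1)).toNat = n by omega, hn, Finset.sum_Icc_succ_top (by omega), if_neg (by omega)]
      have hlast : (-1 : ℚ) ^ (n + 1) * (((i : ℕ) : ℚ) * typeRho L e i (n + 1) + 0) * harm (n + 1) i
          - (i : ℚ) * ((-1 : ℚ) ^ (n + 1) * typeRho L e i (n + 1) * harm (n + 1) i) = 0 := by ring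
      rw [hlast, add_zero]
      refine sum_congr rfl fun σ hσ => ?_
      have hσ' := (mem_Icc.1 hσ)
      rw [typeRho_raiseAt_self, if_pos (by omega)]
      ring
    · have hl : (if e i + 1 < 0 then ∑ σ ∈ Icc 1 (-(e i + 1)).toNat,
          (-1 : ℚ) ^ σ * typeRho L (raiseAt e i) i σ * harm σ i else (0 : ℚ)) = 0 := by
        split_ifs <;> first | rfl | omega
      rw [hl]
      by_cases h0 : e i < 0
      · have h1 : e i = -1 := by omega
        rw [if_pos h0, if_pos h0, h1]
        simp
        ring
      · rw [if_neg h0, if_neg h0]; ring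
  · have hr : raiseAt e k i = e i := by rw [raiseAt, if_neg hik]
    rw [hr]
    by_cases h0 : e i < 0
    · rw [if_pos h0, if_pos h0, if_pos h0, mul_sum, ← sum_sub_distrib]
      refine sum_congr rfl fun σ hσ => ?_
      have hσ' := (mem_Icc.1 hσ)
      rw [typeRho_raiseAt e hk hik (by omega)]
      ring
    · rw [if_neg h0, if_neg h0, if_neg h0]; ring

/-! ## §3 A new end point: `σ(T ++ [1]) = σ₂(T) − (L+1) σ(T)` -/

/-- The product of the extended type at an old point picks up the factor `(i − (L+1)) + ε`. -/
theorem typeProd_snocOne {L : ℕ} (e : ℕ → ℤ) {i : ℕ} (hi : i ≤ L) :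
    typeProd (L + 1) (snocOne e L) i = typeProd L e i * (X + C ((i : ℚ) - ((L + 1 : ℕ) : ℚ))) := by
  have hmem : L + 1 ∈ (range (L + 1 + 1)).erase i := mem_erase.2 ⟨by omega, mem_range.2 (by omega)⟩
  have hδ : ((i : ℚ) - ((L + 1 : ℕ) : ℚ)) ≠ 0 := sub_ne_zero.2 (by exact_mod_cast (show i ≠ L + 1 by omega))
  have hset : ((range (L + 1 + 1)).erase i).erase (L + 1) = (range (L + 1)).erase i := by
    ext j; simp only [mem_erase, mem_range]; omega
  unfold typeProd
  rw [← mul_prod_erase _ _ hmem, hset, snocOne, if_pos rfl, binomSeries_one hδ]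
  have hrest : ∏ j ∈ (range (L + 1)).erase i, binomSeries ((i : ℚ) - j) (snocOne e L j) =
      ∏ j ∈ (range (L + 1)).erase i, binomSeries ((i : ℚ) - j) (e j) :=
    prod_congr rfl fun j hj => by
      rw [snocOne, if_neg (by have := mem_range.1 (mem_erase.1 hj).2; omega)]
  rw [hrest]; ring

/-- `ρ` of `T ++ [1]` at an old point: `(i − (L+1))ρ_{i,σ} + ρ_{i,σ+1}[σ+1 ≤ n_i]`. -/
theorem typeRho_snocOne {L : ℕ} (e : ℕ → ℤ) {i : ℕ} (hi : i ≤ L) {σ : ℕ} (hσ : (σ : ℤ) ≤ -e i) :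
    typeRho (L + 1) (snocOne e L) i σ =
      ((i : ℚ) - ((L + 1 : ℕ) : ℚ)) * typeRho L e i σ + (if (σ : ℤ) + 1 ≤ -e i then typeRho L e i (σ + 1) else 0) := by
  have hei : snocOne e L i = e i := by rw [snocOne, if_neg (by omega)]
  rw [typeRho_eq, typeRho_eq, typeRho_eq, hei, typeProd_snocOne e hi, coeff_mul_X_add_C']
  congr 1
  by_cases h1 : (σ : ℤ) + 1 ≤ -e i
  · rw [if_pos h1, if_neg (by omega), show (-e i).toNat - σ - 1 = (-e i).toNat - (σ + 1) by omega]
  · rw [if_neg h1, if_pos (by omega)]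

/-- **`ŵ(T ++ [1]) = ŵ₂(T) − (L+1) ŵ(T)`.** -/
theorem typeW_snocOne (L : ℕ) (e : ℕ → ℤ) :
    typeW (L + 1) (snocOne e L) = typeW2 L e - ((L + 1 : ℕ) : ℚ) * typeW L e := by
  unfold typeW typeW2
  rw [sum_filter, sum_filter, sum_filter, mul_sum, ← sum_sub_distrib, sum_range_succ,
    show snocOne e L (L + 1) = 1 by rw [snocOne, if_pos rfl], if_neg (by norm_num), add_zero]
  refine sum_congr rfl fun i hi => ?_
  have hiL : i ≤ L := by have := mem_range.1 hi; omega
  have hr : snocOne e L i = e i := by rw [snocOne, if_neg (by omega)]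
  rw [hr]
  by_cases h0 : e i < 0
  · rw [if_pos h0, if_pos h0, if_pos h0]
    by_cases h3 : e i ≤ -3
    · rw [if_pos h3, if_pos h3, if_pos h3, typeRho_snocOne e hiL (by push_cast; omega)]
      by_cases h4 : e i ≤ -4
      · rw [if_pos (by push_cast; omega), if_pos h4]; ring
      · rw [if_neg (by push_cast; omega), if_neg h4]; ring
    · rw [if_neg h3, if_neg h3, if_neg h3, if_neg (by omega)]; ring
  · rw [if_neg h0, if_neg h0, if_neg h0]; ring

/-- **`v̂(T ++ [1]) = v̂₂(T) − (L+1) v̂(T)`.** -/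
theorem typeV_snocOne (L : ℕ) (e : ℕ → ℤ) :
    typeV (L + 1) (snocOne e L) = typeV2 L e - ((L + 1 : ℕ) : ℚ) * typeV L e := by
  unfold typeV typeV2
  rw [sum_filter, sum_filter, sum_filter, mul_sum, ← sum_sub_distrib, sum_range_succ,
    show snocOne e L (L + 1) = 1 by rw [snocOne, if_pos rfl], if_neg (by norm_num), add_zero]
  refine sum_congr rfl fun i hi => ?_
  have hiL : i ≤ L := by have := mem_range.1 hi; omega
  have hr : snocOne e L i = e i := by rw [snocOne, if_neg (by omega)]
  rw [hr]
  by_cases h0 : e i < 0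
  · rw [if_pos h0, if_pos h0, if_pos h0, mul_sum, ← sum_sub_distrib]
    refine sum_congr rfl fun σ hσ => ?_
    have hσ' := (mem_Icc.1 hσ)
    rw [typeRho_snocOne e hiL (by omega)]
    ring
  · rw [if_neg h0, if_neg h0, if_neg h0]; ring

/-! ## §4 A new first point: `σ(1 :: T) = σ₂(T) + σ(T)` (+ the translation term for `v̂`) -/

/-- Reindexing the points `{0,…,L+1} ∖ {i+1}` as `0` and the successors of `{0,…,L} ∖ {i}`. -/
theorem prod_range_succ_erase_succ {M : Type*} [CommMonoid M] (f : ℕ → M) (L i : ℕ) :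
    ∏ j ∈ (range (L + 1 + 1)).erase (i + 1), f j = f 0 * ∏ j ∈ (range (L + 1)).erase i, f (j + 1) := by
  have hset : (range (L + 1 + 1)).erase (i + 1) = insert 0 (((range (L + 1)).erase i).image (· + 1)) := by
    ext j
    simp only [mem_erase, mem_range, mem_insert, mem_image]
    constructor
    · intro h
      rcases j with _ | a
      · exact Or.inl rfl
      · exact Or.inr ⟨a, ⟨by omega, by omega⟩, rfl⟩
    · rintro (rfl | ⟨a, ⟨ha1, ha2⟩, rfl⟩) <;> omega
  rw [hset, prod_insert (by simp), prod_image (fun a _ c _ h => by simpa using h)]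

/-- The product of `1 :: T` at the shifted point `i + 1` is `((i+1) + ε) · G_i`. -/
theorem typeProd_consOne {L : ℕ} (e : ℕ → ℤ) (i : ℕ) :
    typeProd (L + 1) (consOne e) (i + 1) = typeProd L e i * (X + C (((i : ℕ) : ℚ) + 1)) := by
  have hδ : (((i + 1 : ℕ) : ℚ) - ((0 : ℕ) : ℚ)) ≠ 0 := by rw [Nat.cast_zero, sub_zero]; positivity
  unfold typeProd
  rw [prod_range_succ_erase_succ _ L i, show consOne e 0 = 1 by rw [consOne, if_pos rfl], binomSeries_one hδ]
  have hrest : ∏ j ∈ (range (L + 1)).erase i, binomSeries (((i + 1 : ℕ) : ℚ) - ((j + 1 : ℕ) : ℚ)) (consOne e (j + 1)) =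
      ∏ j ∈ (range (L + 1)).erase i, binomSeries ((i : ℚ) - j) (e j) :=
    prod_congr rfl fun j hj => by
      rw [consOne, if_neg (by omega), Nat.add_sub_cancel]
      congr 1; push_cast; ring
  rw [hrest, mul_comm]
  congr 2; push_cast; ring

/-- `ρ` of `1 :: T` at the shifted point: `((i+1))ρ_{i,σ} + ρ_{i,σ+1}[σ+1 ≤ n_i]`. -/
theorem typeRho_consOne {L : ℕ} (e : ℕ → ℤ) (i : ℕ) {σ : ℕ} (hσ : (σ : ℤ) ≤ -e i) :
    typeRho (L + 1) (consOne e) (i + 1) σ =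
      (((i : ℕ) : ℚ) + 1) * typeRho L e i σ + (if (σ : ℤ) + 1 ≤ -e i then typeRho L e i (σ + 1) else 0) := by
  have hei : consOne e (i + 1) = e i := by rw [consOne, if_neg (by omega), Nat.add_sub_cancel]
  rw [typeRho_eq, typeRho_eq, typeRho_eq, hei, typeProd_consOne e i, coeff_mul_X_add_C']
  congr 1
  by_cases h1 : (σ : ℤ) + 1 ≤ -e i
  · rw [if_pos h1, if_neg (by omega), show (-e i).toNat - σ - 1 = (-e i).toNat - (σ + 1) by omega]
  · rw [if_neg h1, if_pos (by omega)]

/-- **`ŵ(1 :: T) = ŵ₂(T) + ŵ(T)`.** -/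
theorem typeW_consOne (L : ℕ) (e : ℕ → ℤ) : typeW (L + 1) (consOne e) = typeW2 L e + typeW L e := by
  unfold typeW typeW2
  rw [sum_filter, sum_filter, sum_filter, ← sum_add_distrib, sum_range_succ',
    show consOne e 0 = 1 by rw [consOne, if_pos rfl], if_neg (by norm_num), add_zero]
  refine sum_congr rfl fun i hi => ?_
  have hiL : i ≤ L := by have := mem_range.1 hi; omega
  have hr : consOne e (i + 1) = e i := by rw [consOne, if_neg (by omega), Nat.add_sub_cancel]
  rw [hr]
  by_cases h0 : e i < 0
  · rw [if_pos h0, if_pos h0, if_pos h0]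
    by_cases h3 : e i ≤ -3
    · rw [if_pos h3, if_pos h3, if_pos h3, typeRho_consOne e i (by push_cast; omega)]
      by_cases h4 : e i ≤ -4
      · rw [if_pos (by push_cast; omega), if_pos h4]; ring
      · rw [if_neg (by push_cast; omega), if_neg h4]; ring
    · rw [if_neg h3, if_neg h3, if_neg h3, if_neg (by omega)]; ring
  · rw [if_neg h0, if_neg h0, if_neg h0]; ring

/-- The TRANSLATION TERM of `v̂` under `T ↦ 1 :: T`: the principal parts of `(η+1)Φ_T` evaluated at `η = −1`,
`corr(T) = Σ_{poles i} Σ_σ (−1)^σ ((i+1)ρ_{i,σ} + ρ_{i,σ+1}[σ+1 ≤ n_i]) (i+1)^{−σ}`. -/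
def typeCorr (L : ℕ) (e : ℕ → ℤ) : ℚ :=
  ∑ i ∈ (range (L + 1)).filter (fun i => e i < 0), ∑ σ ∈ Icc 1 (-e i).toNat,
    (-1 : ℚ) ^ σ * ((((i : ℕ) : ℚ) + 1) * typeRho L e i σ + (if (σ : ℤ) + 1 ≤ -e i then typeRho L e i (σ + 1) else 0))
      * (1 / (((i : ℕ) : ℚ) + 1) ^ σ)

/-- **`v̂(1 :: T) = v̂₂(T) + v̂(T) + corr(T)`.** -/
theorem typeV_consOne (L : ℕ) (e : ℕ → ℤ) :
    typeV (L + 1) (consOne e) = typeV2 L e + typeV L e + typeCorr L e := by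
  unfold typeV typeV2 typeCorr
  rw [sum_filter, sum_filter, sum_filter, sum_filter, ← sum_add_distrib, ← sum_add_distrib, sum_range_succ',
    show consOne e 0 = 1 by rw [consOne, if_pos rfl], if_neg (by norm_num), add_zero]
  refine sum_congr rfl fun i hi => ?_
  have hiL : i ≤ L := by have := mem_range.1 hi; omega
  have hr : consOne e (i + 1) = e i := by rw [consOne, if_neg (by omega), Nat.add_sub_cancel]
  rw [hr]
  by_cases h0 : e i < 0
  · rw [if_pos h0, if_pos h0, if_pos h0, if_pos h0, ← sum_add_distrib, ← sum_add_distrib]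
    refine sum_congr rfl fun σ hσ => ?_
    have hσ' := (mem_Icc.1 hσ)
    rw [typeRho_consOne e i (by omega), harm_succ]
    ring
  · rw [if_neg h0, if_neg h0, if_neg h0, if_neg h0]; ring

end Summit.KontsevichZagierPeriods.Zeta5Search.SecondOrder

end
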